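/-
Copyright (c) 2026 the pub-hodgecm-mathlib formalisation cell (harness21).  Prover seat hodgecm-mathlib-LH7-p07 (g0), Track A «(D-RAM) FOUR-FRAME» squad, helper lane on
h413 = stmt-HodgeConjecture-24833 (count-neutral).  β-BOARD v1 (sub-dealer LH4-p05 (g8)) RULING 15:31:23Z on ROADMAP-R7-TheoremC v1 (LH7-p05 (g0)): L4 to the end —
THE THREE SLOT SUMS OF THE GLUE WINDOW VANISH.  2026-09-04.
-/
import Summits.HodgeConjecture.HodgeConjecture.Theorems.F0P3cDyRamGlueWindowSum        -- (this seat): `image_sub_one_repr`, and through it L4a `sum_sum_glueShell_eq_sum_image`, `glueShell_image_*`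
import Summits.HodgeConjecture.HodgeConjecture.Theorems.F0P3cDyRamGlueClassCharSums     -- ★ p861409 (this seat): the class-isometry engine `sum_eq_zero_of_classIsometry_flip`, (s0) `sum_normSign_mul_one_sub_repr_eq_zero`, `normSign_eq_of_rel_near`; brings ★ `normSign_mul_norm`
import HarnessLib

/-!
# Crux `H413`, line LH4 «(D-RAM) FOUR-FRAME» — β-BOARD R7 «GLUE CLASSES», THEOREM C, L4 TO THE END: the three slot class-functions `ω(r + c₀)`, `ω(r(r + c₀))`,
# `ω((1 + r)(r + c₀))` SUM TO ZERO over every complete irredundant system of the F-shell `{σr = r, |r| = |ϖ|^s, |r + c₀| = |ϖ|^e}` — hence the three GLUE-WINDOW DOUBLE SUMS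
# `Σ_{g ∈ R.filter cut} Σ_{aβ ∈ Aβ} ω(…)` VANISH (all `e ≥ s`, i.e. every `E = e − s ≥ 0`, the on-foot `κ`-class `E = 0` included)

Cell `hodgecm-mathlib` (D-0151), FLOOR 0, crux item H413 = `stmt-HodgeConjecture-24833`, route `HCCMUnconditional`; squad F0∕P3c∕LH4, β-BOARD v1 row R7 (holder LH7-p05 (g0),
`ROADMAP-R7-TheoremC.v1` §2–§3).  THEOREMS ONLY (no `def`, no instance, no notation, no `sorry`, default heartbeats); ★-only imports; lane `--supports stmt-HodgeConjecture-24833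
--as helper`; pays NO row, states NO law.  PURE LOCAL ARITHMETIC (`ω = normSign σ` of the ramified datum; nothing about lattices).

THE ROUTE (no unit-system transport, no appeal to the affine double sums: ONE flip per slot).  Put `h := 1 + r∕c₀` (`|c₀| = |ϖ|^s`): the r-shell maps isometrically (up to the
fixed scale `c₀⁻¹`, modulus `𝔭^N ↦ 𝔭^{N−s}`) ONTO the h-set `B_E := {σh = h, |h| = |ϖ|^E, |1 − h| = 1}`, `E = e − s` (§1 generic image transport, §2), and
`r + c₀ = c₀·h`, `r(r + c₀) = c₀²·(h − 1)h`, `(1 + r)(r + c₀) = c₀·h·(1 − c₀ + c₀h)`.  On `B_E` the multiplication by the ★ non-norm `c ∈ U_F(2d−2)` (`d ≥ 2`) is a class isometry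
that FLIPS `ω(h)` and `ω(h·(1 − c₀ + c₀h))` (the unit `1 − c₀ + c₀h` moves by `c₀(c−1)h`, depth `≥ s + 2d − 2 ≥ 2d − 1`) — ★ p861409's engine kills both sums (§3); the slot-0 sum is
★ p861409 (s0) `Σ ω(h(1−h)) = 0` (the Möbius flip).  §4: the three sums over ANY system `Sh` of the r-shell; §5: the three WINDOW DOUBLE SUMS in ★ (iv-c) ∕ ★ PT-3 letters
(`R hR1 hR2 hR3`, `Aβ hAβsub hAβ`, cut `|g + c₀| = |ϖ|^e`), via L4a on the image system (no class-constancy hypothesis needed by the consumer).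
* §1 `image_repr` (datum-free), §2 `hset_of_shell_image`, §3 `sum_normSign_hset_eq_zero`, `sum_normSign_mul_affine_hset_eq_zero`,
* §4 `sum_normSign_add_shell_eq_zero` (slot 1), `sum_normSign_mul_add_shell_eq_zero` (slot 0), `sum_normSign_one_add_mul_add_shell_eq_zero` (slot 2),
* §5 HEADS `sum_filter_sum_normSign_add_eq_zero`, `sum_filter_sum_normSign_mul_add_eq_zero`, `sum_filter_sum_normSign_one_add_mul_add_eq_zero`.
HONEST LABEL.  Count-neutral arithmetic; R7 Theorem C (the per-representative reduction L3 is LH7-p05's ★ p861537 + FILE 2), the (β) table, (β-BAL), T₊ stay OPEN; `HC_CM` is proved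
only modulo the 7 printed citations (2 remaining named inputs: hLiu418 = `stmt-HodgeConjecture-24832`, h413 = `stmt-HodgeConjecture-24833`) until rung 0 closes.

## References
* [Serre1979] J.-P. Serre, *Local Fields*, GTM 67 (1979): Ch. II §1 (residue systems), Ch. V §3 Cor. 3, Ch. XV §2 (the conductor `d` of `ω`; the non-norm unit at the break).
* [IrelandRosen1990] K. Ireland, M. Rosen, *A Classical Introduction to Modern Number Theory*, GTM 84 (1990): Ch. 8 §3 (Jacobi-type sums; here killed by involutions).
-/

set_option autoImplicit false

noncomputable section

namespace Summit.HodgeConjecture.HodgeConjecture.Cruxes.H413.F0P3cDyRamGlueWindowVanishing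

open WithZero
open scoped Valued
open Literature.NumberTheory.Automorphic.UnitaryThreeFourFrame
open Literature.NumberTheory.LocalFields.WildQuadraticDatum
open Summit.HodgeConjecture.HodgeConjecture.Cruxes.H413.F0P3cDyRamGlueShellLinearisation
open Summit.HodgeConjecture.HodgeConjecture.Cruxes.H413.F0P3cDyRamGlueWindowSum
open Summit.HodgeConjecture.HodgeConjecture.Cruxes.H413.F0P3cDyRamGlueClassCharSums
open Summit.HodgeConjecture.HodgeConjecture.Cruxes.H413.F0P3cDyRamFixedCountDiagonalModel (normSign_mul_norm)

variable {K : Type} [Field K] [Valued K ℤᵐ⁰] {σ : K →+* K} {ϖ : K} {d t : ℕ}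

/-! ## §1  Generic image transport of a complete irredundant system (datum-free) -/

variable [DecidableEq K]

/-- **IMAGE TRANSPORT**: `S` a complete irredundant system of `A` modulo `𝔭^N`; `φ(A) ⊆ B`, every `b ∈ B` is `𝔭^{N′}`-close to some `φ(a)`, and `|φa − φa′| ≤ |ϖ|^{N′} ↔ |a − a′| ≤ |ϖ|^N`
on `A`.  Then `S.image φ` is a complete irredundant system of `B` modulo `𝔭^{N′}`, `φ` is injective on `S`, and `Σ_{s ∈ S} G(φ s) = Σ_{x ∈ S.image φ} G x`. [cite: Serre1979, Ch. II §1] -/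
theorem image_repr {M : Type} [AddCommMonoid M] {A B : Set K} {N N' : ℕ} (S : Finset K) (hS1 : ∀ s ∈ S, s ∈ A)
    (hS2 : ∀ a ∈ A, ∃ s ∈ S, Valued.v (a - s) ≤ Valued.v ϖ ^ N) (hS3 : ∀ s ∈ S, ∀ s' ∈ S, Valued.v (s - s') ≤ Valued.v ϖ ^ N → s = s')
    (φ : K → K) (hφB : ∀ a ∈ A, φ a ∈ B) (hφsurj : ∀ b ∈ B, ∃ a ∈ A, Valued.v (b - φ a) ≤ Valued.v ϖ ^ N')
    (hφ : ∀ a ∈ A, ∀ a' ∈ A, Valued.v (φ a - φ a') ≤ Valued.v ϖ ^ N' ↔ Valued.v (a - a') ≤ Valued.v ϖ ^ N) (G : K → M) :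
    (∀ x ∈ S.image φ, x ∈ B) ∧ (∀ b ∈ B, ∃ x ∈ S.image φ, Valued.v (b - x) ≤ Valued.v ϖ ^ N') ∧
    (∀ x ∈ S.image φ, ∀ x' ∈ S.image φ, Valued.v (x - x') ≤ Valued.v ϖ ^ N' → x = x') ∧
    ∑ s ∈ S, G (φ s) = ∑ x ∈ S.image φ, G x := by
  have hinj : Set.InjOn φ ↑S := by
    intro s hs s' hs' heq
    rw [Finset.mem_coe] at hs hs'
    exact hS3 s hs s' hs' ((hφ s (hS1 s hs) s' (hS1 s' hs')).1 (by rw [heq, sub_self, map_zero]; exact zero_le))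
  refine ⟨?_, ?_, ?_, (Finset.sum_image hinj).symm⟩
  · intro x hx
    obtain ⟨s, hs, rfl⟩ := Finset.mem_image.1 hx
    exact hφB s (hS1 s hs)
  · intro b hb
    obtain ⟨a, ha, hba⟩ := hφsurj b hb
    obtain ⟨s, hs, has⟩ := hS2 a ha
    refine ⟨φ s, Finset.mem_image.2 ⟨s, hs, rfl⟩, ?_⟩
    rw [show b - φ s = (b - φ a) + (φ a - φ s) by ring]
    exact (Valuation.map_add _ _ _).trans (max_le hba ((hφ a ha s (hS1 s hs)).2 has))
  · intro x hx x' hx' hxx'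
    obtain ⟨s, hs, rfl⟩ := Finset.mem_image.1 hx
    obtain ⟨s', hs', rfl⟩ := Finset.mem_image.1 hx'
    rw [hS3 s hs s' hs' ((hφ s (hS1 s hs) s' (hS1 s' hs')).1 hxx')]

/-! ## §2  The r-shell onto the h-set `B_E = {σh = h, |h| = |ϖ|^E, |1 − h| = 1}` by `h = 1 + r∕c₀` -/

/-- **THE h-SET OF THE SHELL**: for `c₀` fixed with `|c₀| = |ϖ|^s`, `s ≤ e`, `s ≤ N`, and `Sh` a complete irredundant system modulo `𝔭^N` of `{σr = r, |r| = |ϖ|^s, |r + c₀| = |ϖ|^e}`,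
the Finset `Sh.image (1 + ·∕c₀)` is a complete irredundant system modulo `𝔭^{N−s}` of `{σh = h, |h| = |ϖ|^{e−s}, |1 − h| = 1}`, and sums transport. [cite: Serre1979, Ch. II §1] -/
theorem hset_of_shell_image {M : Type} [AddCommMonoid M] (hϖ : Valued.v ϖ = exp (-1 : ℤ))
    {s e N : ℕ} (hse : s ≤ e) (hsN : s ≤ N) {c₀ : K} (hσc₀ : σ c₀ = c₀) (hc₀ : Valued.v c₀ = Valued.v ϖ ^ s)
    (Sh : Finset K) (hSh1 : ∀ r ∈ Sh, σ r = r ∧ Valued.v r = Valued.v ϖ ^ s ∧ Valued.v (r + c₀) = Valued.v ϖ ^ e)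
    (hSh2 : ∀ r : K, σ r = r → Valued.v r = Valued.v ϖ ^ s → Valued.v (r + c₀) = Valued.v ϖ ^ e → ∃ x ∈ Sh, Valued.v (r - x) ≤ Valued.v ϖ ^ N)
    (hSh3 : ∀ x ∈ Sh, ∀ x' ∈ Sh, Valued.v (x - x') ≤ Valued.v ϖ ^ N → x = x') (G : K → M) :
    (∀ h ∈ Sh.image (fun r => 1 + r / c₀), σ h = h ∧ Valued.v h = Valued.v ϖ ^ (e - s) ∧ Valued.v (1 - h) = 1) ∧
    (∀ h : K, σ h = h → Valued.v h = Valued.v ϖ ^ (e - s) → Valued.v (1 - h) = 1 → ∃ x ∈ Sh.image (fun r => 1 + r / c₀), Valued.v (h - x) ≤ Valued.v ϖ ^ (N - s)) ∧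
    (∀ x ∈ Sh.image (fun r => 1 + r / c₀), ∀ x' ∈ Sh.image (fun r => 1 + r / c₀), Valued.v (x - x') ≤ Valued.v ϖ ^ (N - s) → x = x') ∧
    ∑ r ∈ Sh, G (1 + r / c₀) = ∑ h ∈ Sh.image (fun r => 1 + r / c₀), G h := by
  have hvϖ0 : Valued.v ϖ ≠ 0 := by rw [hϖ]; exact exp_ne_zero
  have hc₀0 : c₀ ≠ 0 := fun h0 => by rw [h0, map_zero] at hc₀; exact pow_ne_zero _ hvϖ0 hc₀.symm
  have hvc₀0 : Valued.v c₀ ≠ 0 := (Valuation.ne_zero_iff _).2 hc₀0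
  -- the scale: `|x ∕ c₀| ≤ |ϖ|^{N−s} ↔ |x| ≤ |ϖ|^N`
  have hscale : ∀ x : K, Valued.v (x / c₀) ≤ Valued.v ϖ ^ (N - s) ↔ Valued.v x ≤ Valued.v ϖ ^ N := by
    intro x
    rw [map_div₀, div_le_iff₀ ((Valuation.pos_iff _).2 hc₀0), hc₀, ← pow_add, Nat.sub_add_cancel hsN]
  have h := image_repr (A := {r : K | σ r = r ∧ Valued.v r = Valued.v ϖ ^ s ∧ Valued.v (r + c₀) = Valued.v ϖ ^ e})
    (B := {h : K | σ h = h ∧ Valued.v h = Valued.v ϖ ^ (e - s) ∧ Valued.v (1 - h) = 1}) (N' := N - s) Sh hSh1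
    (fun r hr => hSh2 r hr.1 hr.2.1 hr.2.2) hSh3 (fun r => 1 + r / c₀) ?_ ?_ ?_ G
  · obtain ⟨h1, h2, h3, h4⟩ := h
    exact ⟨h1, fun x hσ hv h1x => h2 x ⟨hσ, hv, h1x⟩, h3, h4⟩
  · rintro r ⟨hσr, hvr, hre⟩
    refine ⟨by rw [map_add, map_one, map_div₀, hσr, hσc₀], ?_, ?_⟩
    · rw [show 1 + r / c₀ = (r + c₀) / c₀ by rw [add_div, div_self hc₀0, add_comm], map_div₀, hre, hc₀, div_eq_mul_inv, ← pow_sub₀ _ hvϖ0 hse]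
    · rw [show 1 - (1 + r / c₀) = -(r / c₀) by ring, Valuation.map_neg, map_div₀, hvr, hc₀, div_self (pow_ne_zero _ hvϖ0)]
  · rintro b ⟨hσb, hvb, h1b⟩
    refine ⟨c₀ * (b - 1), ⟨by rw [map_mul, map_sub, map_one, hσc₀, hσb], ?_, ?_⟩, ?_⟩
    · rw [map_mul, hc₀, show b - 1 = -(1 - b) by ring, Valuation.map_neg, h1b, mul_one]
    · rw [show c₀ * (b - 1) + c₀ = c₀ * b by ring, map_mul, hc₀, hvb, ← pow_add, Nat.add_sub_cancel' hse]
    · rw [show b - (1 + c₀ * (b - 1) / c₀) = 0 by rw [mul_div_cancel_left₀ _ hc₀0]; ring, map_zero]; exact zero_le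
  · rintro r - r' -
    rw [show 1 + r / c₀ - (1 + r' / c₀) = (r - r') / c₀ by ring]
    exact hscale (r - r')

/-! ## §3  The two flips on the h-set -/

omit [DecidableEq K] in
/-- h-set letters: `h ∈ B_E` with `|c₀| = |ϖ|^s`, `1 ≤ s` ⟹ `h ≠ 0`, `|h| ≤ 1`, `|c₀h| < 1` and the slot-2 unit `|1 − c₀ + c₀h| = 1`, `σ(1 − c₀ + c₀h) = …`. [cite: Serre1979, Ch. II §1] -/
theorem hset_letters (hϖ : Valued.v ϖ = exp (-1 : ℤ)) {s E : ℕ} (hs : 1 ≤ s) {c₀ : K} (hσc₀ : σ c₀ = c₀) (hc₀ : Valued.v c₀ = Valued.v ϖ ^ s)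
    {h : K} (hσh : σ h = h) (hvh : Valued.v h = Valued.v ϖ ^ E) :
    h ≠ 0 ∧ Valued.v h ≤ 1 ∧ Valued.v (c₀ * h) < 1 ∧ σ (1 - c₀ + c₀ * h) = 1 - c₀ + c₀ * h ∧ Valued.v (1 - c₀ + c₀ * h) = 1 := by
  have hvϖ0 : Valued.v ϖ ≠ 0 := by rw [hϖ]; exact exp_ne_zero
  have hϖ1 : Valued.v ϖ < 1 := by rw [hϖ, ← exp_zero]; exact exp_lt_exp.2 (by norm_num)
  have hh0 : h ≠ 0 := fun h0 => by rw [h0, map_zero] at hvh; exact pow_ne_zero _ hvϖ0 hvh.symm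
  have hh1 : Valued.v h ≤ 1 := by rw [hvh]; exact pow_le_one₀ zero_le hϖ1.le
  have hc₀h : Valued.v (c₀ * h) < 1 := by
    rw [map_mul, hc₀]
    exact mul_lt_one_of_nonneg_of_lt_one_left zero_le (pow_lt_one₀ zero_le hϖ1 (by omega)) hh1
  refine ⟨hh0, hh1, hc₀h, by rw [map_add, map_sub, map_one, map_mul, hσc₀, hσh], ?_⟩
  rw [show 1 - c₀ + c₀ * h = 1 + c₀ * (h - 1) by ring]
  refine Valued.v.map_one_add_of_lt ?_
  rw [map_mul, hc₀, show h - 1 = -(1 - h) by ring, Valuation.map_neg]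
  calc Valued.v ϖ ^ s * Valued.v (1 - h) ≤ Valued.v ϖ ^ s * 1 := by
        refine mul_le_mul' le_rfl ((Valuation.map_sub _ _ _).trans (max_le (le_of_eq (map_one _)) hh1))
    _ < 1 := by rw [mul_one]; exact pow_lt_one₀ zero_le hϖ1 (by omega)

omit [DecidableEq K] in
/-- **FLIP 1: `Σ_{h ∈ S} ω(h) = 0` over a complete irredundant system modulo `𝔭^{N′}` of `B_E = {σh = h, |h| = |ϖ|^E, |1 − h| = 1}`** (`2 ≤ d`, `E + 2d − 1 ≤ N′`): multiplication by
the ★ non-norm `c ∈ U_F(2d−2)` is a class isometry of `B_E` (it keeps `|1 − h| = 1` since `|c − 1| < 1`) and flips `ω`. [cite: Serre1979, Ch. V §3 Cor. 3; Ch. XV §2] -/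
theorem sum_normSign_hset_eq_zero [CompleteSpace K] [Finite 𝓀[K]] (hD : IsRamifiedQuadraticDatum σ ϖ d t) (h2v : Valued.v (2 : K) < 1) (h2d : 2 ≤ d)
    (E : ℕ) {N' : ℕ} (hN : E + (2 * d - 1) ≤ N') (S : Finset K) (hS1 : ∀ h ∈ S, σ h = h ∧ Valued.v h = Valued.v ϖ ^ E ∧ Valued.v (1 - h) = 1)
    (hS2 : ∀ h : K, σ h = h → Valued.v h = Valued.v ϖ ^ E → Valued.v (1 - h) = 1 → ∃ x ∈ S, Valued.v (h - x) ≤ Valued.v ϖ ^ N')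
    (hS3 : ∀ x ∈ S, ∀ x' ∈ S, Valued.v (x - x') ≤ Valued.v ϖ ^ N' → x = x') :
    ∑ h ∈ S, normSign σ h = 0 := by
  obtain ⟨-, -, hϖ, -, -, -, -⟩ := id hD
  have hvϖ0 : Valued.v ϖ ≠ 0 := by rw [hϖ]; exact exp_ne_zero
  have hϖ1 : Valued.v ϖ ≤ 1 := by rw [hϖ, ← exp_zero]; exact exp_le_exp.2 (by norm_num)
  obtain ⟨c, hσc, hc1, hcd, hcn⟩ := exists_fixed_unit_not_norm_v_sub_one_le hD h2v
  have hc1lt : Valued.v (c - 1) < 1 := lt_of_le_of_lt hcd (by rw [← exp_zero, exp_lt_exp]; omega)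
  have hNle : Valued.v ϖ ^ N' ≤ Valued.v ϖ ^ (2 * d - 1) * Valued.v ϖ ^ E := by
    rw [← pow_add]; exact pow_le_pow_right_of_le_one' hϖ1 (by omega)
  refine sum_eq_zero_of_classIsometry_flip (A := {h : K | σ h = h ∧ Valued.v h = Valued.v ϖ ^ E ∧ Valued.v (1 - h) = 1}) S hS1
    (fun h hh => hS2 h hh.1 hh.2.1 hh.2.2) hS3 (fun h => c * h) ?_ ?_ (fun h => normSign σ h) ?_ ?_
  · rintro h ⟨hσh, hvh, h1h⟩
    refine ⟨by rw [map_mul, hσc, hσh], by rw [map_mul, hc1, one_mul, hvh], ?_⟩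
    have hh1 : Valued.v h ≤ 1 := by rw [hvh]; exact pow_le_one₀ zero_le hϖ1
    rw [show 1 - c * h = (1 - h) - (c - 1) * h by ring, Valuation.map_sub_eq_of_lt_left _ ?_, h1h]
    rw [h1h, map_mul]
    exact mul_lt_one_of_nonneg_of_lt_one_left zero_le hc1lt hh1
  · rintro h - h' -
    rw [← mul_sub, map_mul, hc1, one_mul]
  · rintro h ⟨hσh, hvh, -⟩ h' ⟨hσh', -, -⟩ hhh'
    have hh0 : h ≠ 0 := fun h0 => by rw [h0, map_zero] at hvh; exact pow_ne_zero _ hvϖ0 hvh.symm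
    exact (normSign_eq_of_rel_near hD hσh hσh' hh0 le_rfl (hhh'.trans (by rw [hvh]; exact hNle))).symm
  · rintro h ⟨hσh, hvh, -⟩
    have hh0 : h ≠ 0 := fun h0 => by rw [h0, map_zero] at hvh; exact pow_ne_zero _ hvϖ0 hvh.symm
    exact normSign_mul_eq_neg_of_not_norm hD hσc hcn hσh hh0

omit [DecidableEq K] in
/-- **FLIP 2: `Σ_{h ∈ S} ω(h·(1 − c₀ + c₀h)) = 0` over a complete irredundant system modulo `𝔭^{N′}` of `B_E`** (`2 ≤ d`, `1 ≤ s`, `|c₀| = |ϖ|^s`, `E + 2d − 1 ≤ N′`): under `h ↦ ch` the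
unit `1 − c₀ + c₀h` moves by `c₀(c − 1)h` (depth `≥ s + 2d − 2 ≥ 2d − 1`), so its sign stays, while `ω(h)` flips. [cite: Serre1979, Ch. V §3 Cor. 3; Ch. XV §2] -/
theorem sum_normSign_mul_affine_hset_eq_zero [CompleteSpace K] [Finite 𝓀[K]] (hD : IsRamifiedQuadraticDatum σ ϖ d t) (h2v : Valued.v (2 : K) < 1) (h2d : 2 ≤ d)
    {s : ℕ} (hs : 1 ≤ s) {c₀ : K} (hσc₀ : σ c₀ = c₀) (hc₀ : Valued.v c₀ = Valued.v ϖ ^ s)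
    (E : ℕ) {N' : ℕ} (hN : E + (2 * d - 1) ≤ N') (S : Finset K) (hS1 : ∀ h ∈ S, σ h = h ∧ Valued.v h = Valued.v ϖ ^ E ∧ Valued.v (1 - h) = 1)
    (hS2 : ∀ h : K, σ h = h → Valued.v h = Valued.v ϖ ^ E → Valued.v (1 - h) = 1 → ∃ x ∈ S, Valued.v (h - x) ≤ Valued.v ϖ ^ N')
    (hS3 : ∀ x ∈ S, ∀ x' ∈ S, Valued.v (x - x') ≤ Valued.v ϖ ^ N' → x = x') :
    ∑ h ∈ S, normSign σ (h * (1 - c₀ + c₀ * h)) = 0 := by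
  obtain ⟨-, -, hϖ, -, -, -, -⟩ := id hD
  have hvϖ0 : Valued.v ϖ ≠ 0 := by rw [hϖ]; exact exp_ne_zero
  have hϖ1 : Valued.v ϖ ≤ 1 := by rw [hϖ, ← exp_zero]; exact exp_le_exp.2 (by norm_num)
  obtain ⟨c, hσc, hc1, hcd, hcn⟩ := exists_fixed_unit_not_norm_v_sub_one_le hD h2v
  have hc1lt : Valued.v (c - 1) < 1 := lt_of_le_of_lt hcd (by rw [← exp_zero, exp_lt_exp]; omega)
  have hcd' : Valued.v (c - 1) ≤ Valued.v ϖ ^ (2 * (d - 1)) := by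
    rw [v_varpi_pow hϖ]; exact_mod_cast hcd
  have hNle : Valued.v ϖ ^ N' ≤ Valued.v ϖ ^ (2 * d - 1) * Valued.v ϖ ^ E := by
    rw [← pow_add]; exact pow_le_pow_right_of_le_one' hϖ1 (by omega)
  -- the summand and its letters
  have hL : ∀ h : K, σ h = h → Valued.v h = Valued.v ϖ ^ E →
      h ≠ 0 ∧ Valued.v h ≤ 1 ∧ σ (1 - c₀ + c₀ * h) = 1 - c₀ + c₀ * h ∧ Valued.v (1 - c₀ + c₀ * h) = 1 := fun h hσh hvh => by
    obtain ⟨h0, h1, -, hσu, hvu⟩ := hset_letters hϖ hs hσc₀ hc₀ hσh hvh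
    exact ⟨h0, h1, hσu, hvu⟩
  refine sum_eq_zero_of_classIsometry_flip (A := {h : K | σ h = h ∧ Valued.v h = Valued.v ϖ ^ E ∧ Valued.v (1 - h) = 1}) S hS1
    (fun h hh => hS2 h hh.1 hh.2.1 hh.2.2) hS3 (fun h => c * h) ?_ ?_ (fun h => normSign σ (h * (1 - c₀ + c₀ * h))) ?_ ?_
  · rintro h ⟨hσh, hvh, h1h⟩
    refine ⟨by rw [map_mul, hσc, hσh], by rw [map_mul, hc1, one_mul, hvh], ?_⟩
    have hh1 : Valued.v h ≤ 1 := by rw [hvh]; exact pow_le_one₀ zero_le hϖ1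
    rw [show 1 - c * h = (1 - h) - (c - 1) * h by ring, Valuation.map_sub_eq_of_lt_left _ ?_, h1h]
    rw [h1h, map_mul]
    exact mul_lt_one_of_nonneg_of_lt_one_left zero_le hc1lt hh1
  · rintro h - h' -
    rw [← mul_sub, map_mul, hc1, one_mul]
  · -- class-constancy of the summand
    rintro h ⟨hσh, hvh, -⟩ h' ⟨hσh', hvh', -⟩ hhh'
    obtain ⟨hh0, hh1, hσu, hvu⟩ := hL h hσh hvh
    obtain ⟨hh0', -, hσu', hvu'⟩ := hL h' hσh' hvh'
    have hu0 : 1 - c₀ + c₀ * h ≠ 0 := fun h0 => by rw [h0, map_zero] at hvu; exact zero_ne_one hvu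
    -- `h·u(h) − h′·u(h′) = (h − h′)·(1 − c₀ + c₀(h + h′))`
    refine (normSign_eq_of_rel_near hD (by rw [map_mul, hσh, hσu]) (by rw [map_mul, hσh', hσu']) (mul_ne_zero hh0 hu0) le_rfl ?_).symm
    rw [show h * (1 - c₀ + c₀ * h) - h' * (1 - c₀ + c₀ * h') = (h - h') * (1 - c₀ + c₀ * (h + h')) by ring, map_mul, map_mul, hvu, mul_one, hvh]
    have hle : Valued.v (1 - c₀ + c₀ * (h + h')) ≤ 1 := by
      rw [show 1 - c₀ + c₀ * (h + h') = (1 - c₀ + c₀ * h) + c₀ * h' by ring]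
      refine (Valuation.map_add _ _ _).trans (max_le (le_of_eq hvu) ?_)
      exact (hset_letters hϖ hs hσc₀ hc₀ hσh' hvh').2.2.1.le
    calc Valued.v (h - h') * Valued.v (1 - c₀ + c₀ * (h + h')) ≤ Valued.v ϖ ^ N' * 1 := mul_le_mul' hhh' hle
      _ ≤ Valued.v ϖ ^ (2 * d - 1) * Valued.v ϖ ^ E := by rw [mul_one]; exact hNle
  · -- the flip
    rintro h ⟨hσh, hvh, -⟩
    obtain ⟨hh0, hh1, hσu, hvu⟩ := hL h hσh hvh
    have hu0 : 1 - c₀ + c₀ * h ≠ 0 := fun h0 => by rw [h0, map_zero] at hvu; exact zero_ne_one hvu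
    -- `ω((ch)·u(ch)) = ω(c·(h·u(ch))) = −ω(h·u(ch))` and `ω(h·u(ch)) = ω(h·u(h))`
    have hσhu' : σ (h * (1 - c₀ + c₀ * (c * h))) = h * (1 - c₀ + c₀ * (c * h)) := by
      rw [map_mul, map_add, map_sub, map_one, map_mul, map_mul, hσh, hσc₀, hσc]
    have hnear : normSign σ (h * (1 - c₀ + c₀ * (c * h))) = normSign σ (h * (1 - c₀ + c₀ * h)) := by
      refine normSign_eq_of_rel_near hD (by rw [map_mul, hσh, hσu]) hσhu' (mul_ne_zero hh0 hu0) le_rfl ?_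
      have hx : Valued.v (h * (1 - c₀ + c₀ * h)) = Valued.v h := by rw [map_mul, hvu, mul_one]
      rw [hx, show h * (1 - c₀ + c₀ * h) - h * (1 - c₀ + c₀ * (c * h)) = -((c₀ * (c - 1) * h) * h) by ring, Valuation.map_neg, map_mul]
      refine mul_le_mul' ?_ le_rfl
      rw [map_mul, map_mul, hc₀, hvh]
      calc Valued.v ϖ ^ s * Valued.v (c - 1) * Valued.v ϖ ^ E ≤ Valued.v ϖ ^ 1 * Valued.v ϖ ^ (2 * (d - 1)) * 1 := by
            refine mul_le_mul' (mul_le_mul' (pow_le_pow_right_of_le_one' hϖ1 hs) hcd') (pow_le_one₀ zero_le hϖ1)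
        _ = Valued.v ϖ ^ (2 * d - 1) := by rw [mul_one, ← pow_add]; congr 1; omega
    show normSign σ (c * h * (1 - c₀ + c₀ * (c * h))) = -normSign σ (h * (1 - c₀ + c₀ * h))
    rw [mul_assoc, normSign_mul_eq_neg_of_not_norm hD hσc hcn hσhu' (mul_ne_zero hh0 (fun h0 => ?_)), hnear]
    -- `u(ch) ≠ 0`: it is a unit
    have := (hset_letters hϖ hs hσc₀ hc₀ (h := c * h) (by rw [map_mul, hσc, hσh]) (by rw [map_mul, hc1, one_mul, hvh])).2.2.2.2
    rw [h0, map_zero] at this; exact zero_ne_one this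

/-! ## §4  The three slot sums over any system of the r-shell -/

section Slots

variable [CompleteSpace K] [Finite 𝓀[K]]

/-- **SLOT 1: `Σ_{r ∈ Sh} ω(r + c₀) = 0`** over any complete irredundant system modulo `𝔭^N` of `{σr = r, |r| = |ϖ|^s, |r + c₀| = |ϖ|^e}` (`2 ≤ d`, `1 ≤ s ≤ e`, `|c₀| = |ϖ|^s`,
`e + 2d − 1 ≤ N`): `r + c₀ = c₀·h` and FLIP 1 on the h-set. [cite: Serre1979, Ch. V §3 Cor. 3; Ch. XV §2] -/
theorem sum_normSign_add_shell_eq_zero (hD : IsRamifiedQuadraticDatum σ ϖ d t) (h2v : Valued.v (2 : K) < 1) (h2d : 2 ≤ d)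
    {s e N : ℕ} (hs : 1 ≤ s) (hse : s ≤ e) (hN : e + (2 * d - 1) ≤ N) {c₀ : K} (hσc₀ : σ c₀ = c₀) (hc₀ : Valued.v c₀ = Valued.v ϖ ^ s)
    (Sh : Finset K) (hSh1 : ∀ r ∈ Sh, σ r = r ∧ Valued.v r = Valued.v ϖ ^ s ∧ Valued.v (r + c₀) = Valued.v ϖ ^ e)
    (hSh2 : ∀ r : K, σ r = r → Valued.v r = Valued.v ϖ ^ s → Valued.v (r + c₀) = Valued.v ϖ ^ e → ∃ x ∈ Sh, Valued.v (r - x) ≤ Valued.v ϖ ^ N)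
    (hSh3 : ∀ x ∈ Sh, ∀ x' ∈ Sh, Valued.v (x - x') ≤ Valued.v ϖ ^ N → x = x') :
    ∑ r ∈ Sh, normSign σ (r + c₀) = 0 := by
  obtain ⟨-, -, hϖ, -, -, -, -⟩ := id hD
  have hvϖ0 : Valued.v ϖ ≠ 0 := by rw [hϖ]; exact exp_ne_zero
  have hc₀0 : c₀ ≠ 0 := fun h0 => by rw [h0, map_zero] at hc₀; exact pow_ne_zero _ hvϖ0 hc₀.symm
  obtain ⟨hB1, hB2, hB3, hsum⟩ := hset_of_shell_image hϖ hse (by omega) hσc₀ hc₀ Sh hSh1 hSh2 hSh3 (fun h => normSign σ h)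
  -- `ω(r + c₀) = ω(c₀)·ω(1 + r∕c₀)`
  have hterm : ∀ r ∈ Sh, normSign σ (r + c₀) = normSign σ c₀ * normSign σ (1 + r / c₀) := fun r hr => by
    obtain ⟨hσr, -, -⟩ := hSh1 r hr
    obtain ⟨hσh, hvh, -⟩ := hB1 _ (Finset.mem_image.2 ⟨r, hr, rfl⟩)
    have hh0 := (hset_letters hϖ hs hσc₀ hc₀ hσh hvh).1
    rw [show r + c₀ = c₀ * (1 + r / c₀) by rw [mul_add, mul_one, mul_div_cancel₀ r hc₀0, add_comm], normSign_mul_of_fixed hD hσc₀ hσh hc₀0 hh0]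
  rw [Finset.sum_congr rfl hterm, ← Finset.mul_sum, hsum, sum_normSign_hset_eq_zero hD h2v h2d (e - s) (by omega) _ hB1 hB2 hB3, mul_zero]

/-- **SLOT 0: `Σ_{r ∈ Sh} ω(r·(r + c₀)) = 0`** (same data): `r(r + c₀) = (c₀σc₀)·((h − 1)h)` (`c₀` fixed: a norm factor, ★ `normSign_mul_norm`), `ω((h−1)h) = ω(−1)ω(h(1−h))`, and
★ p861409 (s0) the Möbius flip. [cite: IrelandRosen1990, Ch. 8 §3] [cite: Serre1979, Ch. XV §2] -/
theorem sum_normSign_mul_add_shell_eq_zero (hD : IsRamifiedQuadraticDatum σ ϖ d t) (h2v : Valued.v (2 : K) < 1) (h2d : 2 ≤ d)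
    {s e N : ℕ} (hs : 1 ≤ s) (hse : s ≤ e) (hN : e + (2 * d - 1) ≤ N) {c₀ : K} (hσc₀ : σ c₀ = c₀) (hc₀ : Valued.v c₀ = Valued.v ϖ ^ s)
    (Sh : Finset K) (hSh1 : ∀ r ∈ Sh, σ r = r ∧ Valued.v r = Valued.v ϖ ^ s ∧ Valued.v (r + c₀) = Valued.v ϖ ^ e)
    (hSh2 : ∀ r : K, σ r = r → Valued.v r = Valued.v ϖ ^ s → Valued.v (r + c₀) = Valued.v ϖ ^ e → ∃ x ∈ Sh, Valued.v (r - x) ≤ Valued.v ϖ ^ N)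
    (hSh3 : ∀ x ∈ Sh, ∀ x' ∈ Sh, Valued.v (x - x') ≤ Valued.v ϖ ^ N → x = x') :
    ∑ r ∈ Sh, normSign σ (r * (r + c₀)) = 0 := by
  obtain ⟨-, -, hϖ, -, -, -, -⟩ := id hD
  have hvϖ0 : Valued.v ϖ ≠ 0 := by rw [hϖ]; exact exp_ne_zero
  have hc₀0 : c₀ ≠ 0 := fun h0 => by rw [h0, map_zero] at hc₀; exact pow_ne_zero _ hvϖ0 hc₀.symm
  have hσm1 : σ (-1 : K) = -1 := by rw [map_neg, map_one]
  obtain ⟨hB1, hB2, hB3, hsum⟩ := hset_of_shell_image hϖ hse (by omega) hσc₀ hc₀ Sh hSh1 hSh2 hSh3 (fun h => normSign σ (h * (1 - h)))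
  have hterm : ∀ r ∈ Sh, normSign σ (r * (r + c₀)) = normSign σ (-1) * normSign σ ((1 + r / c₀) * (1 - (1 + r / c₀))) := fun r hr => by
    obtain ⟨hσr, -, -⟩ := hSh1 r hr
    obtain ⟨hσh, hvh, h1h⟩ := hB1 _ (Finset.mem_image.2 ⟨r, hr, rfl⟩)
    have hh0 := (hset_letters hϖ hs hσc₀ hc₀ hσh hvh).1
    have h1h0 : 1 - (1 + r / c₀) ≠ 0 := fun h0 => by rw [h0, map_zero] at h1h; exact zero_ne_one h1h
    have e1 : r * (r + c₀) = (-1 * ((1 + r / c₀) * (1 - (1 + r / c₀)))) * (c₀ * σ c₀) := by rw [hσc₀]; field_simp; ring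
    rw [e1, normSign_mul_norm σ _ hc₀0, normSign_mul_of_fixed hD hσm1 (by rw [map_mul, map_sub, map_one, hσh]) (by norm_num) (mul_ne_zero hh0 h1h0)]
  rw [Finset.sum_congr rfl hterm, ← Finset.mul_sum, hsum,
    sum_normSign_mul_one_sub_repr_eq_zero hD h2v h2d (e - s) (by omega) _ hB1 hB2 hB3, mul_zero]

/-- **SLOT 2: `Σ_{r ∈ Sh} ω((1 + r)·(r + c₀)) = 0`** (same data): `(1 + r)(r + c₀) = c₀·(h·(1 − c₀ + c₀h))` and FLIP 2 on the h-set. [cite: Serre1979, Ch. V §3 Cor. 3; Ch. XV §2] -/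
theorem sum_normSign_one_add_mul_add_shell_eq_zero (hD : IsRamifiedQuadraticDatum σ ϖ d t) (h2v : Valued.v (2 : K) < 1) (h2d : 2 ≤ d)
    {s e N : ℕ} (hs : 1 ≤ s) (hse : s ≤ e) (hN : e + (2 * d - 1) ≤ N) {c₀ : K} (hσc₀ : σ c₀ = c₀) (hc₀ : Valued.v c₀ = Valued.v ϖ ^ s)
    (Sh : Finset K) (hSh1 : ∀ r ∈ Sh, σ r = r ∧ Valued.v r = Valued.v ϖ ^ s ∧ Valued.v (r + c₀) = Valued.v ϖ ^ e)
    (hSh2 : ∀ r : K, σ r = r → Valued.v r = Valued.v ϖ ^ s → Valued.v (r + c₀) = Valued.v ϖ ^ e → ∃ x ∈ Sh, Valued.v (r - x) ≤ Valued.v ϖ ^ N)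
    (hSh3 : ∀ x ∈ Sh, ∀ x' ∈ Sh, Valued.v (x - x') ≤ Valued.v ϖ ^ N → x = x') :
    ∑ r ∈ Sh, normSign σ ((1 + r) * (r + c₀)) = 0 := by
  obtain ⟨-, -, hϖ, -, -, -, -⟩ := id hD
  have hvϖ0 : Valued.v ϖ ≠ 0 := by rw [hϖ]; exact exp_ne_zero
  have hc₀0 : c₀ ≠ 0 := fun h0 => by rw [h0, map_zero] at hc₀; exact pow_ne_zero _ hvϖ0 hc₀.symm
  obtain ⟨hB1, hB2, hB3, hsum⟩ := hset_of_shell_image hϖ hse (by omega) hσc₀ hc₀ Sh hSh1 hSh2 hSh3 (fun h => normSign σ (h * (1 - c₀ + c₀ * h)))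
  have hterm : ∀ r ∈ Sh, normSign σ ((1 + r) * (r + c₀)) = normSign σ c₀ * normSign σ ((1 + r / c₀) * (1 - c₀ + c₀ * (1 + r / c₀))) := fun r hr => by
    obtain ⟨hσr, -, -⟩ := hSh1 r hr
    obtain ⟨hσh, hvh, -⟩ := hB1 _ (Finset.mem_image.2 ⟨r, hr, rfl⟩)
    obtain ⟨hh0, -, -, hσu, hvu⟩ := hset_letters hϖ hs hσc₀ hc₀ hσh hvh
    have hu0 : 1 - c₀ + c₀ * (1 + r / c₀) ≠ 0 := fun h0 => by rw [h0, map_zero] at hvu; exact zero_ne_one hvu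
    rw [show (1 + r) * (r + c₀) = c₀ * ((1 + r / c₀) * (1 - c₀ + c₀ * (1 + r / c₀))) by field_simp; ring,
      normSign_mul_of_fixed hD hσc₀ (by rw [map_mul, hσh, hσu]) hc₀0 (mul_ne_zero hh0 hu0)]
  rw [Finset.sum_congr rfl hterm, ← Finset.mul_sum, hsum,
    sum_normSign_mul_affine_hset_eq_zero hD h2v h2d hs hσc₀ hc₀ (e - s) (by omega) _ hB1 hB2 hB3, mul_zero]

end Slots

/-! ## §5  HEADS — the three glue-window double sums vanish (★ (iv-c) ∕ ★ PT-3 letters, no class-constancy hypothesis) -/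

section Window

variable [CompleteSpace K] [Finite 𝓀[K]]

omit [Finite 𝓀[K]] in
/-- **THE GLUE-WINDOW DOUBLE SUM OF A SHELL-VANISHING SUMMAND VANISHES**: under the WINDOW data of `F0P3cDyRamGlueWindowSum.sum_filter_sum_eq_sum_shell` (without `Sh`, `F`, `hF`), for any
`G : K → ℤ` whose sum over EVERY complete irredundant system modulo `𝔭^{2M}` of the shell `{σr = r, |r| = |ϖ|^s, |r + c₀| = |ϖ|^e}` is `0`:
`Σ_{g ∈ R.filter cut} Σ_{aβ ∈ Aβ} G(g + (1+g)(aβ − 1)) = 0` (L4a on the image system). [cite: Serre1979, Ch. II §1] -/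
theorem sum_filter_sum_eq_zero_of_shell (hD : IsRamifiedQuadraticDatum σ ϖ d t)
    {s n k M e : ℕ} (hs : 1 ≤ s) (hsn : s < n) (hen : e < n) (hnM : n ≤ 2 * M) (hMk : 2 * M ≤ k + d) (hkM : k + d ≤ 2 * M + 1) (hdM : d ≤ M) (hMk2 : M ≤ k)
    {c₀ : K} (R : Finset K) (hR1 : ∀ g ∈ R, σ g = g ∧ Valued.v g = Valued.v ϖ ^ s)
    (hR2 : ∀ f : K, σ f = f → Valued.v f = Valued.v ϖ ^ s → ∃ g ∈ R, Valued.v (f - g) ≤ Valued.v ϖ ^ n)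
    (hR3 : ∀ g ∈ R, ∀ g' ∈ R, Valued.v (g - g') ≤ Valued.v ϖ ^ n → g = g')
    (Aβ : Finset K) (hAβsub : ∀ a ∈ Aβ, σ a = a ∧ Valued.v (a - 1) ≤ Valued.v ϖ ^ n)
    (hAβ : ∀ y : K, σ y = y → Valued.v (y - 1) ≤ Valued.v ϖ ^ n → ∃! a, a ∈ Aβ ∧ ∃ s : K, Valued.v (s - 1) ≤ Valued.v ϖ ^ k ∧ s * σ s = a / y)
    (G : K → ℤ)
    (hG : ∀ Sh : Finset K, (∀ r ∈ Sh, σ r = r ∧ Valued.v r = Valued.v ϖ ^ s ∧ Valued.v (r + c₀) = Valued.v ϖ ^ e) →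
      (∀ r : K, σ r = r → Valued.v r = Valued.v ϖ ^ s → Valued.v (r + c₀) = Valued.v ϖ ^ e → ∃ x ∈ Sh, Valued.v (r - x) ≤ Valued.v ϖ ^ (2 * M)) →
      (∀ x ∈ Sh, ∀ x' ∈ Sh, Valued.v (x - x') ≤ Valued.v ϖ ^ (2 * M) → x = x') → ∑ r ∈ Sh, G r = 0) :
    ∑ g ∈ R.filter (fun g => Valued.v (g + c₀) = Valued.v ϖ ^ e), ∑ a ∈ Aβ, G (g + (1 + g) * (a - 1)) = 0 := by
  obtain ⟨-, -, hϖ, -, -, -, -⟩ := id hD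
  obtain ⟨hB1, hB2, hB3⟩ := image_sub_one_repr hD (by omega) hMk hkM hdM hMk2 Aβ hAβsub hAβ
  have hinj : Set.InjOn (fun a : K => a - 1) ↑Aβ := fun a _ a' _ h => sub_left_injective h
  have hinner : ∀ g : K, ∑ a ∈ Aβ, G (g + (1 + g) * (a - 1)) = ∑ b ∈ Aβ.image (fun a => a - 1), G (g + (1 + g) * b) := fun g => by
    rw [Finset.sum_image hinj]
  rw [Finset.sum_congr rfl fun g _ => hinner g, sum_sum_glueShell_eq_sum_image (σ := σ) hϖ hs hsn hnM R hR1 hR3 _ hB1 hB3 G]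
  exact hG _ (glueShell_image_sub hϖ hs hsn hen R hR1 _ hB1) (glueShell_image_complete hϖ hs hen R hR1 hR2 _ hB2)
    (glueShell_image_irredundant hϖ hs hsn hnM R hR1 hR3 _ hB1 hB3)

/-- **HEAD, SLOT 1: `Σ_{g ∈ R.filter cut} Σ_{aβ ∈ Aβ} ω((g + (1+g)(aβ − 1)) + c₀) = 0`** (window data; `2 ≤ d`, `s ≤ e`, `|c₀| = |ϖ|^s`, `e + 2d − 1 ≤ 2M`).
[cite: Serre1979, Ch. V §3 Cor. 3; Ch. XV §2] -/
theorem sum_filter_sum_normSign_add_eq_zero (hD : IsRamifiedQuadraticDatum σ ϖ d t) (h2v : Valued.v (2 : K) < 1) (h2d : 2 ≤ d)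
    {s n k M e : ℕ} (hs : 1 ≤ s) (hsn : s < n) (hse : s ≤ e) (hen : e < n) (hnM : n ≤ 2 * M) (heM : e + (2 * d - 1) ≤ 2 * M)
    (hMk : 2 * M ≤ k + d) (hkM : k + d ≤ 2 * M + 1) (hdM : d ≤ M) (hMk2 : M ≤ k)
    {c₀ : K} (hσc₀ : σ c₀ = c₀) (hc₀ : Valued.v c₀ = Valued.v ϖ ^ s) (R : Finset K) (hR1 : ∀ g ∈ R, σ g = g ∧ Valued.v g = Valued.v ϖ ^ s)
    (hR2 : ∀ f : K, σ f = f → Valued.v f = Valued.v ϖ ^ s → ∃ g ∈ R, Valued.v (f - g) ≤ Valued.v ϖ ^ n)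
    (hR3 : ∀ g ∈ R, ∀ g' ∈ R, Valued.v (g - g') ≤ Valued.v ϖ ^ n → g = g')
    (Aβ : Finset K) (hAβsub : ∀ a ∈ Aβ, σ a = a ∧ Valued.v (a - 1) ≤ Valued.v ϖ ^ n)
    (hAβ : ∀ y : K, σ y = y → Valued.v (y - 1) ≤ Valued.v ϖ ^ n → ∃! a, a ∈ Aβ ∧ ∃ s : K, Valued.v (s - 1) ≤ Valued.v ϖ ^ k ∧ s * σ s = a / y) :
    ∑ g ∈ R.filter (fun g => Valued.v (g + c₀) = Valued.v ϖ ^ e), ∑ a ∈ Aβ, normSign σ ((g + (1 + g) * (a - 1)) + c₀) = 0 :=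
  sum_filter_sum_eq_zero_of_shell hD hs hsn hen hnM hMk hkM hdM hMk2 R hR1 hR2 hR3 Aβ hAβsub hAβ (fun r => normSign σ (r + c₀))
    (fun Sh h1 h2 h3 => sum_normSign_add_shell_eq_zero hD h2v h2d hs hse heM hσc₀ hc₀ Sh h1 h2 h3)

/-- **HEAD, SLOT 0: `Σ_{g ∈ R.filter cut} Σ_{aβ ∈ Aβ} ω(r·(r + c₀)) = 0`, `r = g + (1+g)(aβ − 1)`** (window data as in slot 1). [cite: IrelandRosen1990, Ch. 8 §3] [cite: Serre1979, Ch. XV §2] -/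
theorem sum_filter_sum_normSign_mul_add_eq_zero (hD : IsRamifiedQuadraticDatum σ ϖ d t) (h2v : Valued.v (2 : K) < 1) (h2d : 2 ≤ d)
    {s n k M e : ℕ} (hs : 1 ≤ s) (hsn : s < n) (hse : s ≤ e) (hen : e < n) (hnM : n ≤ 2 * M) (heM : e + (2 * d - 1) ≤ 2 * M)
    (hMk : 2 * M ≤ k + d) (hkM : k + d ≤ 2 * M + 1) (hdM : d ≤ M) (hMk2 : M ≤ k)
    {c₀ : K} (hσc₀ : σ c₀ = c₀) (hc₀ : Valued.v c₀ = Valued.v ϖ ^ s) (R : Finset K) (hR1 : ∀ g ∈ R, σ g = g ∧ Valued.v g = Valued.v ϖ ^ s)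
    (hR2 : ∀ f : K, σ f = f → Valued.v f = Valued.v ϖ ^ s → ∃ g ∈ R, Valued.v (f - g) ≤ Valued.v ϖ ^ n)
    (hR3 : ∀ g ∈ R, ∀ g' ∈ R, Valued.v (g - g') ≤ Valued.v ϖ ^ n → g = g')
    (Aβ : Finset K) (hAβsub : ∀ a ∈ Aβ, σ a = a ∧ Valued.v (a - 1) ≤ Valued.v ϖ ^ n)
    (hAβ : ∀ y : K, σ y = y → Valued.v (y - 1) ≤ Valued.v ϖ ^ n → ∃! a, a ∈ Aβ ∧ ∃ s : K, Valued.v (s - 1) ≤ Valued.v ϖ ^ k ∧ s * σ s = a / y) :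
    ∑ g ∈ R.filter (fun g => Valued.v (g + c₀) = Valued.v ϖ ^ e), ∑ a ∈ Aβ,
      normSign σ ((g + (1 + g) * (a - 1)) * ((g + (1 + g) * (a - 1)) + c₀)) = 0 :=
  sum_filter_sum_eq_zero_of_shell hD hs hsn hen hnM hMk hkM hdM hMk2 R hR1 hR2 hR3 Aβ hAβsub hAβ (fun r => normSign σ (r * (r + c₀)))
    (fun Sh h1 h2 h3 => sum_normSign_mul_add_shell_eq_zero hD h2v h2d hs hse heM hσc₀ hc₀ Sh h1 h2 h3)

/-- **HEAD, SLOT 2: `Σ_{g ∈ R.filter cut} Σ_{aβ ∈ Aβ} ω((1 + r)·(r + c₀)) = 0`, `r = g + (1+g)(aβ − 1)`** (window data as in slot 1). [cite: Serre1979, Ch. V §3 Cor. 3; Ch. XV §2] -/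
theorem sum_filter_sum_normSign_one_add_mul_add_eq_zero (hD : IsRamifiedQuadraticDatum σ ϖ d t) (h2v : Valued.v (2 : K) < 1) (h2d : 2 ≤ d)
    {s n k M e : ℕ} (hs : 1 ≤ s) (hsn : s < n) (hse : s ≤ e) (hen : e < n) (hnM : n ≤ 2 * M) (heM : e + (2 * d - 1) ≤ 2 * M)
    (hMk : 2 * M ≤ k + d) (hkM : k + d ≤ 2 * M + 1) (hdM : d ≤ M) (hMk2 : M ≤ k)
    {c₀ : K} (hσc₀ : σ c₀ = c₀) (hc₀ : Valued.v c₀ = Valued.v ϖ ^ s) (R : Finset K) (hR1 : ∀ g ∈ R, σ g = g ∧ Valued.v g = Valued.v ϖ ^ s)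
    (hR2 : ∀ f : K, σ f = f → Valued.v f = Valued.v ϖ ^ s → ∃ g ∈ R, Valued.v (f - g) ≤ Valued.v ϖ ^ n)
    (hR3 : ∀ g ∈ R, ∀ g' ∈ R, Valued.v (g - g') ≤ Valued.v ϖ ^ n → g = g')
    (Aβ : Finset K) (hAβsub : ∀ a ∈ Aβ, σ a = a ∧ Valued.v (a - 1) ≤ Valued.v ϖ ^ n)
    (hAβ : ∀ y : K, σ y = y → Valued.v (y - 1) ≤ Valued.v ϖ ^ n → ∃! a, a ∈ Aβ ∧ ∃ s : K, Valued.v (s - 1) ≤ Valued.v ϖ ^ k ∧ s * σ s = a / y) :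
    ∑ g ∈ R.filter (fun g => Valued.v (g + c₀) = Valued.v ϖ ^ e), ∑ a ∈ Aβ,
      normSign σ ((1 + (g + (1 + g) * (a - 1))) * ((g + (1 + g) * (a - 1)) + c₀)) = 0 :=
  sum_filter_sum_eq_zero_of_shell hD hs hsn hen hnM hMk hkM hdM hMk2 R hR1 hR2 hR3 Aβ hAβsub hAβ (fun r => normSign σ ((1 + r) * (r + c₀)))
    (fun Sh h1 h2 h3 => sum_normSign_one_add_mul_add_shell_eq_zero hD h2v h2d hs hse heM hσc₀ hc₀ Sh h1 h2 h3)

end Window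

end Summit.HodgeConjecture.HodgeConjecture.Cruxes.H413.F0P3cDyRamGlueWindowVanishing

end
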